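import Literature.Probability.RandomPlanarGeometry.SLEBubblesAssembly
import HarnessLib

/-!
# Brownian bubble measures agree on the events that see interior points: `SLEBubbles.ae_interior_nonempty` from the existential fact

Fourth companion of `Literature.Probability.RandomPlanarGeometry.SLEBubbles` ([LSW] §7.2), after

* G. F. Lawler, O. Schramm, W. Werner, *Conformal restriction: the chordal case*, J. Amer. Math.
  Soc. **16** (2003) 917–955, arXiv:math/0209343 (**[LSW]**), §7.1 (pp. 27–28): the Brownian
  bubble measure `μ` and its hitting masses (7.2) `μ[K ∩ A ≠ ∅] = −SΦ_A(0)/6`, `A ∈ 𝒬*`;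
  §3 p. 10 (for `Ω`): "It is easy to check that this family of events is closed under finite
  intersection, so that a probability measure on `Ω` is characterized by the values of
  `P[K ∩ A = ∅]` for `A ∈ 𝒬*`."

The tree DEFINES a Brownian bubble measure by (7.2) (`IsBrownianBubbleMeasure`, file
`BrownianBubbles`) and states the interior property of the bubbles twice: for EVERY such
measure (`IsBrownianBubbleMeasure.ae_interior_nonempty`, whence
`SLEBubbles.ae_interior_nonempty`, "which presupposes that (7.2) determines `μ`") and, faithful
to [LSW] who construct ONE `μ`, existentially
(`exists_isBrownianBubbleMeasure_ae_interior_nonempty`, file `SLEBubblesAssembly`). This file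
PROVES the missing link, the bubble version of [LSW]'s remark of §3 p. 10:

* `Literature.Probability.RandomPlanarGeometry.measure_eq_of_union_closed` — two measures that
  agree, with finite values, on a family `𝓗` of measurable sets closed under binary unions and
  containing a countable cover agree on `σ(𝓗)` (inclusion–exclusion
  `μ(A ∩ E) = μ(A) + μ(E) − μ(A ∪ E)` and `A ∪ ⋂ᵢ Bᵢ = ⋂ᵢ (A ∪ Bᵢ)` make the nonempty finite
  intersections of `𝓗` a π-system on which they agree; then Dynkin, on the trimmed measures);
* the family `𝓗_b` of hitting events `{K ∩ S ≠ ∅}` of the test sets `S` which are closed,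
  bounded, attached (`S ∪ {Im ≤ 0}` connected) and off a corner `{Im < δ, Re < δ}` at `0`
  ("attached to the positive axis"): such an `S` has `0 ∉ Fill(S) ∈ 𝒬*`
  (`isStarHull_hpFill_of_corner`, the tree's `hpFill`/`isStarHull_hpFill`, [LSW] §2 "Fillings"),
  a bubble hits `Fill(S)` iff it hits `S` (`BubbleConfig.hit_hpFill_of_corner`: a bubble is
  connected and accumulates at `0`, inside the corner, which lies in the unbounded component of
  `ℍ ∖ S`), so by (7.2) all Brownian bubble measures give `{K ∩ S ≠ ∅}` the same finite mass;
  the family is closed under unions (`S ∪ S'`) and the boxes with a leg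
  `[−m−1, m+1] × [1/(m+1), m+1] ∪ {m+1} × [0, m+1]` give a countable cover
  (`BubbleConfig.exists_boxLeg_cover`) — hence ALL BROWNIAN BUBBLE MEASURES AGREE ON `σ(𝓗_b)`
  (`IsBrownianBubbleMeasure.measure_eq_of_measurableSet_generateFrom`);
* `σ(𝓗_b)` sees interior points (`BubbleConfig.measurableSet_generateFrom_interior_nonempty`):
  `{int K ≠ ∅} = ⋃_B ⋂_S {K ∩ S ≠ ∅}` over the rational discs `B ⊆ ℍ` and the finite unions
  `S` of dyadic squares in the family meeting `B`, because a point of `ℍ` off a bubble lies in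
  such an `S` avoided by the bubble (`BubbleConfig.exists_dyadicUnion_corner`, the construction
  of `BubbleConfig.exists_dyadicUnion_isStarHull_hpFill` of `SLEBubblesCloud` with its
  attachment data retained);
* hence `IsBrownianBubbleMeasure.ae_interior_nonempty_of_exists` and
  `SLEBubbles.ae_interior_nonempty_of_exists`: the two universally quantified facts follow from
  the existential, source-faithful `exists_isBrownianBubbleMeasure_ae_interior_nonempty`
  ([LSW] §7.1: the measure of filled Brownian loops, whose fillings have interior points);
* moreover `σ(𝓗_b)` is the WHOLE avoidance σ-field (`BubbleConfig.generateFrom_cornerHits_eq`):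
  the hitting event of a `*`-hull `A` is `⋃ₘ ⋂_S {K ∩ S ≠ ∅}` over the compact slabs
  `A ∩ {Im ≥ 1/(m+1)}` and the finite unions `S` of attached dyadic test sets containing them
  (`BubbleConfig.measurableSet_generateFrom_hit`, by a finite subcover of the dyadic
  neighbourhoods `BubbleConfig.exists_dyadicUnion_corner_nhds`), so that **(7.2) determines the
  Brownian bubble measure**: `IsBrownianBubbleMeasure.unique` (`μ = ν`), the design note of
  `BrownianBubbles` proved and the bubble analogue of [LSW] Lemma 3.2; with the transfer
  `IsBrownianBubbleMeasure.ae_of_exists` and the measurability of `{int K ≠ ∅}`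
  (`BubbleConfig.measurableSet_interior_nonempty`);
* bookkeeping (D-0026 review, 2026-08-15): hence the existential fact is exactly the conjunction
  of the two facts of `BrownianBubbles`, `exists_isBrownianBubbleMeasure_ae_interior_nonempty_iff`
  (`D2 ↔ D1 ∧ C`), so that `IsBrownianBubbleMeasure.ae_interior_nonempty` is discharged by one
  line from the existential fact and carries no independent proof obligation.

Mathlib: `MeasureTheory.Measure.ext_of_generateFrom_of_iUnion`, `Measure.trim`,
`trim_measurableSet_eq`, `measure_union_add_inter`, `Finset.set_biInter_insert`,
`IsCompact.exists_cthickening_subset_open`, `IsCompact.elim_nhds_subcover`, `JoinedIn.somePath`,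
`isPreconnected_of_forall`, `exists_rat_btwn`, `Finset.exists_min_image`.
-/

noncomputable section

open Set Filter Topology MeasureTheory Metric Bornology
open UpperHalfPlane (upperHalfPlaneSet isOpen_upperHalfPlaneSet)
open scoped NNReal ENNReal

namespace Literature.Probability.RandomPlanarGeometry

/-! ### Measures agreeing on a union-closed family agree on the generated σ-field -/

section UnionClosed

variable {Ω : Type*} [MeasurableSpace Ω] {𝓗 : Set (Set Ω)} {μ ν : Measure Ω}

/-- **Inclusion–exclusion**: `μ(A ∩ E) = μ(A) + μ(E) − μ(A ∪ E)` for `E` measurable and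
`μ(A), μ(E)` finite. [folklore] -/
theorem measure_inter_eq_add_sub_union {A E : Set Ω} (hE : MeasurableSet E) (hA : μ A ≠ ∞)
    (hEfin : μ E ≠ ∞) : μ (A ∩ E) = μ A + μ E - μ (A ∪ E) := by
  have h := measure_union_add_inter A hE (μ := μ)
  have hfin : μ (A ∪ E) ≠ ∞ :=
    ((measure_union_le A E).trans_lt (ENNReal.add_lt_top.2 ⟨hA.lt_top, hEfin.lt_top⟩)).ne
  rw [add_comm] at h
  exact ENNReal.eq_sub_of_add_eq hfin h

/-- **Two measures agreeing with finite values on a union-closed family `𝓗` of measurable sets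
agree on the nonempty finite intersections of members of `𝓗`** (induction on the number of
sets: `A ∪ ⋂ᵢ Bᵢ = ⋂ᵢ (A ∪ Bᵢ)` is again such an intersection, with fewer sets, and
`μ(A ∩ E) = μ(A) + μ(E) − μ(A ∪ E)`). [folklore] -/
theorem measure_biInter_eq_of_union_closed (hmeas : ∀ A ∈ 𝓗, MeasurableSet A)
    (hunion : ∀ A ∈ 𝓗, ∀ B ∈ 𝓗, A ∪ B ∈ 𝓗) (hfin : ∀ A ∈ 𝓗, μ A ≠ ∞)
    (h : ∀ A ∈ 𝓗, μ A = ν A) {s : Finset (Set Ω)} (hne : s.Nonempty) (hsub : ∀ A ∈ s, A ∈ 𝓗) :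
    μ (⋂ A ∈ s, A) = ν (⋂ A ∈ s, A) := by
  classical
  suffices H : ∀ (n : ℕ) (s : Finset (Set Ω)), s.card = n → s.Nonempty → (∀ A ∈ s, A ∈ 𝓗) →
      μ (⋂ A ∈ s, A) = ν (⋂ A ∈ s, A) from H _ s rfl hne hsub
  intro n
  induction n using Nat.strong_induction_on with
  | _ n ih =>
  intro s hcard hne hsub
  obtain ⟨A, hA⟩ := hne
  have hA𝓗 : A ∈ 𝓗 := hsub A hA
  set s' : Finset (Set Ω) := s.erase A with hs'
  have hs'sub : ∀ B ∈ s', B ∈ 𝓗 := fun B hB ↦ hsub B (Finset.mem_of_mem_erase hB)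
  have hs'card : s'.card < n := by
    rw [hs', Finset.card_erase_of_mem hA, hcard]
    have : 0 < n := hcard ▸ Finset.card_pos.2 ⟨A, hA⟩
    omega
  rw [← Finset.insert_erase hA, Finset.set_biInter_insert, ← hs']
  set E : Set Ω := ⋂ B ∈ s', B with hEdef
  rcases s'.eq_empty_or_nonempty with hs'e | hs'ne
  · have hE : E = univ := by rw [hEdef, hs'e]; simp
    rw [hE, inter_univ]
    exact h A hA𝓗
  · -- `E` is measurable and of finite mass, and `μ E = ν E` by induction
    have hEmeas : MeasurableSet E := Finset.measurableSet_biInter s' fun B hB ↦ hmeas B (hs'sub B hB)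
    obtain ⟨B₀, hB₀⟩ := hs'ne
    have hEB₀ : E ⊆ B₀ := biInter_subset_of_mem hB₀
    have hEfin : μ E ≠ ∞ := ((measure_mono hEB₀).trans_lt (hfin B₀ (hs'sub B₀ hB₀)).lt_top).ne
    have hEeq : μ E = ν E := ih _ hs'card s' rfl ⟨B₀, hB₀⟩ hs'sub
    -- `A ∪ E` is the intersection of the fewer sets `A ∪ B`, `B ∈ s'`
    set t : Finset (Set Ω) := s'.image fun B ↦ A ∪ B with ht
    have htsub : ∀ C ∈ t, C ∈ 𝓗 := fun C hC ↦ by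
      obtain ⟨B, hB, rfl⟩ := Finset.mem_image.1 hC
      exact hunion A hA𝓗 B (hs'sub B hB)
    have htcard : t.card < n := (Finset.card_image_le).trans_lt hs'card
    have htne : t.Nonempty := ⟨A ∪ B₀, Finset.mem_image.2 ⟨B₀, hB₀, rfl⟩⟩
    have hAE : A ∪ E = ⋂ C ∈ t, C := by
      ext z
      simp only [hEdef, ht, mem_union, mem_iInter, Finset.mem_image]
      constructor
      · rintro (hz | hz) C ⟨B, hB, rfl⟩
        · exact Or.inl hz
        · exact Or.inr (hz B hB)
      · intro hz
        by_cases hzA : z ∈ A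
        · exact Or.inl hzA
        · refine Or.inr fun B hB ↦ ?_
          rcases hz (A ∪ B) ⟨B, hB, rfl⟩ with h' | h'
          · exact absurd h' hzA
          · exact h'
    have hAEeq : μ (A ∪ E) = ν (A ∪ E) := by
      rw [hAE]
      exact ih _ htcard t rfl htne htsub
    -- inclusion–exclusion on both sides
    have hAfin : μ A ≠ ∞ := hfin A hA𝓗
    rw [measure_inter_eq_add_sub_union hEmeas hAfin hEfin,
      measure_inter_eq_add_sub_union hEmeas (by rw [← h A hA𝓗]; exact hAfin)
        (by rw [← hEeq]; exact hEfin),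
      h A hA𝓗, hEeq, hAEeq]

/-- **Two measures agreeing with finite values on a union-closed family `𝓗` of measurable sets
which contains a countable cover of the space agree on the σ-field generated by `𝓗`** (the
nonempty finite intersections of members of `𝓗` form a π-system generating the same σ-field,
on which the measures agree by `measure_biInter_eq_of_union_closed`; Dynkin's π-λ theorem for
the measures trimmed to `σ(𝓗)`). This is the form of [LSW]'s remark "this family of events is
closed under finite intersection, so that a probability measure … is characterized by the values
of `P[K ∩ A = ∅]`" (§3 p. 10) suited to HITTING events `{K ∩ A ≠ ∅}` of an infinite measure.
[folklore] -/
theorem measure_eq_of_union_closed (hmeas : ∀ A ∈ 𝓗, MeasurableSet A)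
    (hunion : ∀ A ∈ 𝓗, ∀ B ∈ 𝓗, A ∪ B ∈ 𝓗) (T : ℕ → Set Ω) (hT : ∀ n, T n ∈ 𝓗)
    (hcover : ⋃ n, T n = univ) (hfin : ∀ A ∈ 𝓗, μ A ≠ ∞) (h : ∀ A ∈ 𝓗, μ A = ν A)
    {E : Set Ω} (hE : MeasurableSet[MeasurableSpace.generateFrom 𝓗] E) : μ E = ν E := by
  classical
  have hle : MeasurableSpace.generateFrom 𝓗 ≤ ‹MeasurableSpace Ω› :=
    MeasurableSpace.generateFrom_le hmeas
  -- the π-system of nonempty finite intersections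
  set C : Set (Set Ω) :=
    {S | ∃ s : Finset (Set Ω), s.Nonempty ∧ (∀ A ∈ s, A ∈ 𝓗) ∧ S = ⋂ A ∈ s, A} with hC
  have hCpi : IsPiSystem C := by
    rintro _ ⟨s, hs, hs𝓗, rfl⟩ _ ⟨t, -, ht𝓗, rfl⟩ _
    refine ⟨s ∪ t, hs.mono Finset.subset_union_left, fun A hA ↦ ?_,
      (Finset.set_biInter_inter s t _).symm⟩
    rcases Finset.mem_union.1 hA with h' | h'
    · exact hs𝓗 A h'
    · exact ht𝓗 A h'
  have h𝓗C : 𝓗 ⊆ C := fun A hA ↦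
    ⟨{A}, Finset.singleton_nonempty A, by simpa using hA, by simp⟩
  have hCm : ∀ S ∈ C, MeasurableSet[MeasurableSpace.generateFrom 𝓗] S := by
    rintro _ ⟨s, -, hs𝓗, rfl⟩
    exact Finset.measurableSet_biInter s fun A hA ↦
      MeasurableSpace.measurableSet_generateFrom (hs𝓗 A hA)
  have hgen : MeasurableSpace.generateFrom 𝓗 = MeasurableSpace.generateFrom C :=
    le_antisymm (MeasurableSpace.generateFrom_mono h𝓗C) (MeasurableSpace.generateFrom_le hCm)
  -- the trimmed measures agree (Dynkin)
  have key : μ.trim hle = ν.trim hle := by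
    refine @Measure.ext_of_generateFrom_of_iUnion Ω (MeasurableSpace.generateFrom 𝓗) (μ.trim hle)
      (ν.trim hle) C T hgen hCpi hcover (fun n ↦ h𝓗C (hT n)) (fun n ↦ ?_) ?_
    · rw [trim_measurableSet_eq hle (hCm _ (h𝓗C (hT n)))]
      exact hfin _ (hT n)
    · intro S hS
      rw [trim_measurableSet_eq hle (hCm S hS), trim_measurableSet_eq hle (hCm S hS)]
      obtain ⟨s, hs, hs𝓗, rfl⟩ := hS
      exact measure_biInter_eq_of_union_closed hmeas hunion hfin h hs hs𝓗
  have hμ : μ.trim hle E = μ E := trim_measurableSet_eq hle hE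
  have hν : ν.trim hle E = ν E := trim_measurableSet_eq hle hE
  rw [← hμ, ← hν, key]

end UnionClosed

/-! ### Test sets off a corner at `0`: the corner lies in the unbounded component -/

section Corner

variable {S : Set ℂ} {δ : ℝ}

/-- The corner `{0 < Im < δ, Re < δ}` is convex. [folklore] -/
theorem convex_corner (δ : ℝ) : Convex ℝ {z : ℂ | 0 < z.im ∧ z.im < δ ∧ z.re < δ} := by
  have : {z : ℂ | 0 < z.im ∧ z.im < δ ∧ z.re < δ} =
      {w : ℂ | 0 < w.im} ∩ ({w : ℂ | w.im < δ} ∩ {w : ℂ | w.re < δ}) := by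
    ext w
    simp
  rw [this]
  exact (convex_halfSpace_im_gt 0).inter ((convex_halfSpace_im_lt _).inter (convex_halfSpace_re_lt _))

/-- The corner is unbounded (it contains `−x + iδ/2` for all large `x`). [folklore] -/
theorem not_isBounded_corner (hδ : 0 < δ) : ¬ IsBounded {z : ℂ | 0 < z.im ∧ z.im < δ ∧ z.re < δ} := by
  intro hb
  obtain ⟨R', hR'pos, hR'⟩ := hb.subset_closedBall_lt 0 0
  set w : ℂ := ((-(R' + 1) : ℝ) : ℂ) + ((δ / 2 : ℝ) : ℂ) * Complex.I with hw
  have hwre : w.re = -(R' + 1) := by simp [hw]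
  have hwim : w.im = δ / 2 := by simp [hw]
  have hwL : w ∈ {z : ℂ | 0 < z.im ∧ z.im < δ ∧ z.re < δ} := by
    refine ⟨by rw [hwim]; positivity, by rw [hwim]; linarith, by rw [hwre]; linarith⟩
  have h1 := hR' hwL
  rw [mem_closedBall, dist_zero_right] at h1
  have h2 := (Complex.abs_re_le_norm w).trans h1
  rw [hwre, abs_neg, abs_of_pos (by positivity)] at h2
  linarith

/-- A point of `ℍ` of norm `< δ` lies in the corner. [folklore] -/
theorem mem_corner_of_norm_lt {u : ℂ} (huH : u ∈ upperHalfPlaneSet) (hu : ‖u‖ < δ) :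
    u ∈ {z : ℂ | 0 < z.im ∧ z.im < δ ∧ z.re < δ} :=
  ⟨huH, ((le_abs_self _).trans (Complex.abs_im_le_norm u)).trans_lt hu,
    ((le_abs_self _).trans (Complex.abs_re_le_norm u)).trans_lt hu⟩

/-- The corner misses a test set off the corner. [folklore] -/
theorem corner_subset_diff (hSδ : ∀ z ∈ S, δ ≤ z.im ∨ δ ≤ z.re) :
    {z : ℂ | 0 < z.im ∧ z.im < δ ∧ z.re < δ} ⊆ upperHalfPlaneSet \ S := fun w hw ↦
  ⟨hw.1, fun hwS ↦ by
    rcases hSδ w hwS with h | h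
    · exact absurd hw.2.1 (not_lt.2 h)
    · exact absurd hw.2.2 (not_lt.2 h)⟩

/-- **The corner lies in the unbounded component of `ℍ ∖ S`** for a test set `S` off the corner
(the corner is connected, unbounded and misses `S`). [folklore] -/
theorem corner_subset_unboundedComponent (hδ : 0 < δ) (hSδ : ∀ z ∈ S, δ ≤ z.im ∨ δ ≤ z.re) :
    {z : ℂ | 0 < z.im ∧ z.im < δ ∧ z.re < δ} ⊆ Loewner.unboundedComponent (upperHalfPlaneSet \ S) :=
  subset_unboundedComponent_of_isPreconnected (convex_corner δ).isPreconnected (corner_subset_diff hSδ)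
    (not_isBounded_corner hδ)

/-- **`0 ∉ Fill(S)`** for a test set `S` off a corner at `0`: the half-ball `B(0, δ) ∩ ℍ` lies in
the corner, inside the unbounded component `V`, so `0 ∉ cl (ℍ ∖ V) = hpFill S`. [folklore] -/
theorem zero_notMem_hpFill_of_corner (hδ : 0 < δ) (hSδ : ∀ z ∈ S, δ ≤ z.im ∨ δ ≤ z.re) :
    (0 : ℂ) ∉ hpFill S := by
  intro h0
  change (0 : ℂ) ∈ closure (upperHalfPlaneSet \ Loewner.unboundedComponent (upperHalfPlaneSet \ S)) at h0
  rw [_root_.mem_closure_iff] at h0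
  obtain ⟨u, huδ, huH, huV⟩ := h0 (ball 0 δ) isOpen_ball (mem_ball_self hδ)
  rw [mem_ball, dist_zero_right] at huδ
  exact huV (corner_subset_unboundedComponent hδ hSδ (mem_corner_of_norm_lt huH huδ))

/-- **`Fill(S) ∈ 𝒬*`** for a closed bounded test set `S` attached to the real axis
(`S ∪ {Im ≤ 0}` connected) and off a corner at `0` ([LSW] §2 "Fillings"; the tree's
`isStarHull_hpFill` with Conway VIII.2.2 proved, `isSimplyConnected_of_isConnected_compl_holds`).
[cite: LawlerSchrammWerner2003Restriction, §2 p. 8 (Fillings, *-hulls)] -/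
theorem isStarHull_hpFill_of_corner (hS : IsClosed S) (hSb : IsBounded S)
    (hSc : IsConnected (S ∪ {z : ℂ | z.im ≤ 0})) (hδ : 0 < δ)
    (hSδ : ∀ z ∈ S, δ ≤ z.im ∨ δ ≤ z.re) : IsStarHull (hpFill S) :=
  isStarHull_hpFill isSimplyConnected_of_isConnected_compl_holds hS hSb hSc
    (zero_notMem_hpFill_of_corner hδ hSδ)

namespace BubbleConfig

/-- **A bubble avoiding a test set off a corner lies in the unbounded component of its
complement**: the bubble is connected and accumulates at `0`, so it meets the corner, which is
connected, unbounded and off `S`. [folklore] -/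
theorem subset_unboundedComponent_of_disjoint (K : BubbleConfig) (hδ : 0 < δ)
    (hSδ : ∀ z ∈ S, δ ≤ z.im ∨ δ ≤ z.re) (hKS : Disjoint (K : Set ℂ) S) :
    (K : Set ℂ) ⊆ Loewner.unboundedComponent (upperHalfPlaneSet \ S) := by
  -- a point of `K` in the corner
  obtain ⟨k, hkK, hkδ⟩ : ((K : Set ℂ) ∩ ball 0 δ).Nonempty := by
    have := K.zero_mem_closure
    rw [_root_.mem_closure_iff] at this
    obtain ⟨k, hk1, hk2⟩ := this (ball 0 δ) isOpen_ball (mem_ball_self hδ)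
    exact ⟨k, hk2, hk1⟩
  rw [mem_ball, dist_zero_right] at hkδ
  have hkL := mem_corner_of_norm_lt (K.subset_upperHalfPlaneSet hkK) hkδ
  have hT : (K : Set ℂ) ∪ {z : ℂ | 0 < z.im ∧ z.im < δ ∧ z.re < δ} ⊆
      Loewner.unboundedComponent (upperHalfPlaneSet \ S) := by
    refine subset_unboundedComponent_of_isPreconnected ?_ ?_ ?_
    · exact IsPreconnected.union k hkK hkL K.isConnected.isPreconnected (convex_corner δ).isPreconnected
    · rintro w (hwK | hwL)
      · exact ⟨K.subset_upperHalfPlaneSet hwK, fun hwS ↦ Set.disjoint_left.1 hKS hwK hwS⟩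
      · exact corner_subset_diff hSδ hwL
    · exact fun hb ↦ not_isBounded_corner hδ (hb.subset subset_union_right)
  exact subset_union_left.trans hT

/-- **A bubble avoids the fill of a test set off a corner iff it avoids the test set** (`S`
closed and bounded). [folklore] -/
theorem disjoint_hpFill_iff (K : BubbleConfig) (hS : IsClosed S) (hSb : IsBounded S) (hδ : 0 < δ)
    (hSδ : ∀ z ∈ S, δ ≤ z.im ∨ δ ≤ z.re) :
    Disjoint (K : Set ℂ) (hpFill S) ↔ Disjoint (K : Set ℂ) S := by
  constructor
  · intro h
    exact Set.disjoint_left.2 fun w hwK hwS ↦ Set.disjoint_left.1 h hwK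
      (inter_subset_hpFill S ⟨hwS, K.subset_upperHalfPlaneSet hwK⟩)
  · intro h
    refine Set.disjoint_left.2 fun w hwK hwF ↦ ?_
    have hV := K.subset_unboundedComponent_of_disjoint hδ hSδ h hwK
    rw [← diff_hpFill hS hSb] at hV
    exact hV.2 hwF

/-- **Hitting the fill is hitting the test set**, for test sets off a corner. [folklore] -/
theorem hit_hpFill_of_corner (hS : IsClosed S) (hSb : IsBounded S) (hδ : 0 < δ)
    (hSδ : ∀ z ∈ S, δ ≤ z.im ∨ δ ≤ z.re) : hit (hpFill S) = hit S := by
  ext K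
  simp only [mem_hit, K.disjoint_hpFill_iff hS hSb hδ hSδ]

/-- The hitting event of an attached test set off a corner is measurable (it is the hitting
event of the `*`-hull `Fill(S)`). [folklore] -/
theorem measurableSet_hit_of_corner (hS : IsClosed S) (hSb : IsBounded S)
    (hSc : IsConnected (S ∪ {z : ℂ | z.im ≤ 0})) (hδ : 0 < δ)
    (hSδ : ∀ z ∈ S, δ ≤ z.im ∨ δ ≤ z.re) : MeasurableSet (hit S) := by
  rw [← hit_hpFill_of_corner hS hSb hδ hSδ]
  exact measurableSet_hit (isStarHull_hpFill_of_corner hS hSb hSc hδ hSδ)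

/-- Hitting a union is hitting one of the sets. [folklore] -/
theorem hit_union (A B : Set ℂ) : hit (A ∪ B) = hit A ∪ hit B := by
  ext K
  simp only [mem_hit, mem_union, Set.disjoint_union_right, not_and_or]

end BubbleConfig

/-- **All Brownian bubble measures give the same finite mass to the hitting event of an attached
test set off a corner**: by (7.2) for the `*`-hull `Fill(S)`, `μ[K ∩ S ≠ ∅] = −SΦ_{Fill(S)}(0)/6`
(restriction map and jet exist: `IsStarHull.existsUnique_isRestrictionMap_holds`,
`IsStarHull.exists_hasRestrictionJet_holds`). [cite: LawlerSchrammWerner2003Restriction, §7.1 eq. (7.2) (p. 28)] -/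
theorem IsBrownianBubbleMeasure.measure_hit_eq_of_corner {μ ν : Measure BubbleConfig}
    (hμ : IsBrownianBubbleMeasure μ) (hν : IsBrownianBubbleMeasure ν) (hS : IsClosed S)
    (hSb : IsBounded S) (hSc : IsConnected (S ∪ {z : ℂ | z.im ≤ 0})) (hδ : 0 < δ)
    (hSδ : ∀ z ∈ S, δ ≤ z.im ∨ δ ≤ z.re) :
    μ (BubbleConfig.hit S) = ν (BubbleConfig.hit S) ∧ μ (BubbleConfig.hit S) ≠ ∞ := by
  have hA := isStarHull_hpFill_of_corner hS hSb hSc hδ hSδ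
  obtain ⟨Φ, hΦ, -⟩ := IsStarHull.existsUnique_isRestrictionMap_holds hA
  obtain ⟨d, c₂, c₃, hJ⟩ := IsStarHull.exists_hasRestrictionJet_holds hA hΦ
  rw [← BubbleConfig.hit_hpFill_of_corner hS hSb hδ hSδ, hμ hA hΦ hJ, hν hA hΦ hJ]
  exact ⟨rfl, ENNReal.ofReal_ne_top⟩

end Corner

/-! ### A countable cover of `Ω_b` by hitting events of boxes with a leg -/

/-- **Boxes with a leg cover the bubbles**: the test sets
`T_m = [−(m+1), m+1] × [1/(m+1), m+1] ∪ {m+1} × [0, m+1]` are closed, bounded, attached to the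
real axis and off the corner of size `1/(m+1)`, and every bubble hits one of them (a bubble has
a point `x + iy`, `y > 0`; take `m + 1 ≥ max(1/y, y, |x|)`). [folklore] -/
theorem BubbleConfig.exists_boxLeg_cover :
    ∃ T : ℕ → Set ℂ, (∀ m, IsClosed (T m) ∧ IsBounded (T m) ∧
      IsConnected (T m ∪ {z : ℂ | z.im ≤ 0}) ∧
        ∀ z ∈ T m, (1 : ℝ) / (m + 1) ≤ z.im ∨ (1 : ℝ) / (m + 1) ≤ z.re) ∧
      ∀ K : BubbleConfig, ∃ m, ¬ Disjoint (K : Set ℂ) (T m) := by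
  set box : ℕ → Set ℂ := fun m ↦ {z : ℂ | (1 : ℝ) / (m + 1) ≤ z.im ∧ z.im ≤ m + 1 ∧
    -((m : ℝ) + 1) ≤ z.re ∧ z.re ≤ m + 1} with hbox
  set leg : ℕ → Set ℂ := fun m ↦ {z : ℂ | z.re = m + 1 ∧ 0 ≤ z.im ∧ z.im ≤ m + 1} with hleg
  have hm0 : ∀ m : ℕ, (0 : ℝ) ≤ m := fun m ↦ Nat.cast_nonneg m
  have hm1 : ∀ m : ℕ, (1 : ℝ) / (m + 1) ≤ m + 1 := fun m ↦ by
    rw [div_le_iff₀ (by positivity)]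
    nlinarith [hm0 m]
  have hbox_eq : ∀ m : ℕ, box m = (Complex.im ⁻¹' Icc ((1 : ℝ) / (m + 1)) (m + 1)) ∩
      (Complex.re ⁻¹' Icc (-((m : ℝ) + 1)) (m + 1)) := fun m ↦ by
    ext z
    simp only [hbox, mem_setOf_eq, mem_inter_iff, mem_preimage, mem_Icc]
    tauto
  have hleg_eq : ∀ m : ℕ, leg m = (Complex.re ⁻¹' {(m : ℝ) + 1}) ∩
      (Complex.im ⁻¹' Icc 0 ((m : ℝ) + 1)) := fun m ↦ by
    ext z
    simp only [hleg, mem_setOf_eq, mem_inter_iff, mem_preimage, mem_Icc, mem_singleton_iff]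
  refine ⟨fun m ↦ box m ∪ leg m, fun m ↦ ⟨?_, ?_, ?_, ?_⟩, fun K ↦ ?_⟩
  · -- closed
    have hb : IsClosed (box m) := by
      rw [hbox_eq]
      exact (isClosed_Icc.preimage Complex.continuous_im).inter (isClosed_Icc.preimage Complex.continuous_re)
    have hl : IsClosed (leg m) := by
      rw [hleg_eq]
      exact (isClosed_singleton.preimage Complex.continuous_re).inter
        (isClosed_Icc.preimage Complex.continuous_im)
    exact hb.union hl
  · -- bounded
    rw [isBounded_iff_forall_norm_le]
    refine ⟨2 * ((m : ℝ) + 1), ?_⟩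
    rintro z (⟨h1, h2, h3, h4⟩ | ⟨h1, h2, h3⟩)
    · refine (Complex.norm_le_abs_re_add_abs_im z).trans ?_
      have hre : |z.re| ≤ m + 1 := abs_le.2 ⟨h3, h4⟩
      have him : |z.im| ≤ m + 1 :=
        abs_le.2 ⟨by linarith [(by positivity : (0 : ℝ) < 1 / (m + 1))], h2⟩
      linarith
    · refine (Complex.norm_le_abs_re_add_abs_im z).trans ?_
      rw [h1, abs_of_nonneg (by positivity), abs_of_nonneg h2]
      linarith
  · -- attached: box and leg share `(m+1) + (m+1) i`, leg and lower half-plane share `m+1`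
    set p : ℂ := (((m : ℝ) + 1 : ℝ) : ℂ) + (((m : ℝ) + 1 : ℝ) : ℂ) * Complex.I with hp
    have hpre : p.re = m + 1 := by simp [hp]
    have hpim : p.im = m + 1 := by simp [hp]
    have hpbox : p ∈ box m := by
      refine ⟨by rw [hpim]; exact hm1 m, by rw [hpim], by rw [hpre]; linarith [hm0 m], by rw [hpre]⟩
    have hpleg : p ∈ leg m := ⟨hpre, by rw [hpim]; positivity, by rw [hpim]⟩
    set q : ℂ := (((m : ℝ) + 1 : ℝ) : ℂ) with hq
    have hqleg : q ∈ leg m := ⟨by simp [hq], by simp [hq], by simp [hq]; positivity⟩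
    have hqH : q ∈ {z : ℂ | z.im ≤ 0} := by simp [hq]
    have hboxc : Convex ℝ (box m) := by
      rw [hbox_eq]
      exact ((convex_Icc _ _).linear_preimage Complex.imLm).inter
        ((convex_Icc _ _).linear_preimage Complex.reLm)
    have hlegc : Convex ℝ (leg m) := by
      rw [hleg_eq]
      exact ((convex_singleton _).linear_preimage Complex.reLm).inter
        ((convex_Icc _ _).linear_preimage Complex.imLm)
    have h1 : IsConnected (box m ∪ leg m) :=
      IsConnected.union ⟨p, hpbox, hpleg⟩ (hboxc.isConnected ⟨p, hpbox⟩) (hlegc.isConnected ⟨p, hpleg⟩)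
    exact IsConnected.union ⟨q, Or.inr hqleg, hqH⟩ h1
      ((convex_halfSpace_im_le 0).isConnected ⟨0, by simp⟩)
  · -- off the corner of size `1/(m+1)`
    rintro z (⟨h1, -, -, -⟩ | ⟨h1, -, -⟩)
    · exact Or.inl h1
    · exact Or.inr (by rw [h1]; exact hm1 m)
  · -- cover
    obtain ⟨k, hk⟩ := K.nonempty
    have hkim : 0 < k.im := K.subset_upperHalfPlaneSet hk
    obtain ⟨m₁, hm₁⟩ := exists_nat_ge (1 / k.im)
    obtain ⟨m₂, hm₂⟩ := exists_nat_ge k.im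
    obtain ⟨m₃, hm₃⟩ := exists_nat_ge |k.re|
    refine ⟨m₁ + m₂ + m₃, fun hd ↦ Set.disjoint_left.1 hd hk (Or.inl ⟨?_, ?_, ?_, ?_⟩)⟩
    · rw [div_le_iff₀ (by positivity)]
      rw [div_le_iff₀ hkim] at hm₁
      push_cast
      nlinarith [hm0 m₂, hm0 m₃]
    · push_cast
      linarith [hm0 m₁, hm0 m₃]
    · push_cast
      linarith [(abs_le.1 hm₃).1, hm0 m₁, hm0 m₂]
    · push_cast
      linarith [(abs_le.1 hm₃).2, hm0 m₁, hm0 m₂]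

/-! ### All Brownian bubble measures agree on the σ-field of the attached hitting events -/

/-- **All Brownian bubble measures agree on the σ-field `σ(𝓗_b)`** generated by the hitting
events `{K ∩ S ≠ ∅}` of the closed bounded test sets `S` attached to the real axis and off a
corner at `0` (through (7.2) they agree with finite values on this family, which is closed under
unions — `{K ∩ S ≠ ∅} ∪ {K ∩ S' ≠ ∅} = {K ∩ (S ∪ S') ≠ ∅}` — and contains the countable cover
by boxes with a leg; `measure_eq_of_union_closed`). This is the part of "(7.2) determines `μ`"
(the design note of `BrownianBubbles`) that the interior property needs.
[cite: LawlerSchrammWerner2003Restriction, §7.1 eq. (7.2) (p. 28) with §3 p. 10] -/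
theorem IsBrownianBubbleMeasure.measure_eq_of_measurableSet_generateFrom {μ ν : Measure BubbleConfig}
    (hμ : IsBrownianBubbleMeasure μ) (hν : IsBrownianBubbleMeasure ν) {E : Set BubbleConfig}
    (hE : MeasurableSet[MeasurableSpace.generateFrom
      {E : Set BubbleConfig | ∃ (S : Set ℂ) (δ : ℝ), IsClosed S ∧ IsBounded S ∧
        IsConnected (S ∪ {z : ℂ | z.im ≤ 0}) ∧ 0 < δ ∧ (∀ z ∈ S, δ ≤ z.im ∨ δ ≤ z.re) ∧
          E = BubbleConfig.hit S}] E) :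
    μ E = ν E := by
  obtain ⟨T, hT, hcov⟩ := BubbleConfig.exists_boxLeg_cover
  refine measure_eq_of_union_closed ?_ ?_ (fun m ↦ BubbleConfig.hit (T m)) (fun m ↦ ?_) ?_ ?_ ?_ hE
  · rintro _ ⟨S, δ, hS, hSb, hSc, hδ, hSδ, rfl⟩
    exact BubbleConfig.measurableSet_hit_of_corner hS hSb hSc hδ hSδ
  · rintro _ ⟨S, δ, hS, hSb, hSc, hδ, hSδ, rfl⟩ _ ⟨S', δ', hS', hSb', hSc', hδ', hSδ', rfl⟩
    refine ⟨S ∪ S', min δ δ', hS.union hS', hSb.union hSb', ?_, lt_min hδ hδ', ?_,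
      (BubbleConfig.hit_union S S').symm⟩
    · have heq : (S ∪ S') ∪ {z : ℂ | z.im ≤ 0} = (S ∪ {z : ℂ | z.im ≤ 0}) ∪ (S' ∪ {z : ℂ | z.im ≤ 0}) := by
        ext z
        simp only [mem_union, mem_setOf_eq]
        tauto
      rw [heq]
      exact IsConnected.union ⟨0, Or.inr (by simp), Or.inr (by simp)⟩ hSc hSc'
    · rintro z (hz | hz)
      · rcases hSδ z hz with h | h
        · exact Or.inl ((min_le_left _ _).trans h)
        · exact Or.inr ((min_le_left _ _).trans h)
      · rcases hSδ' z hz with h | h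
        · exact Or.inl ((min_le_right _ _).trans h)
        · exact Or.inr ((min_le_right _ _).trans h)
  · obtain ⟨h1, h2, h3, h4⟩ := hT m
    exact ⟨T m, 1 / (m + 1), h1, h2, h3, by positivity, h4, rfl⟩
  · refine eq_univ_of_forall fun K ↦ ?_
    obtain ⟨m, hm⟩ := hcov K
    exact mem_iUnion.2 ⟨m, hm⟩
  · rintro _ ⟨S, δ, hS, hSb, hSc, hδ, hSδ, rfl⟩
    exact (hμ.measure_hit_eq_of_corner hν hS hSb hSc hδ hSδ).2
  · rintro _ ⟨S, δ, hS, hSb, hSc, hδ, hSδ, rfl⟩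
    exact (hμ.measure_hit_eq_of_corner hν hS hSb hSc hδ hSδ).1


/-! ### Separation of bubbles by attached dyadic test sets off a corner -/

namespace BubbleConfig

/-- **A point of `ℍ` off a bubble has a neighbourhood which is a finite union of dyadic squares,
attached to the real axis, off a corner at `0`, and avoided by the bubble** — the construction
of `BubbleConfig.exists_dyadicUnion_isStarHull_hpFill` (`SLEBubblesCloud`) with its attachment
data retained and a small closed disc about `z` added: join `z` to the far point
`w₀ = R + 2 + i` (`K ⊆ B̄(0, R)`) inside the open connected set `ℍ ∖ K` ([LSW] §7.1: "`ℍ ∖ K`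
is connected"), add a closed disc about `z` inside `ℍ ∖ K`, continue by the stick `[R + 2, w₀]`
down to the real axis, and take the dyadic squares of a fine generation meeting this compact
connected set: they form a closed bounded neighbourhood `S` of `z` off `cl K = K ∪ {0}`, with
`S ∪ {Im ≤ 0}` connected, inside `{Im ≥ η/2} ∪ {Re ≥ R + 1}` (`η = min Im` on path and
disc), i.e. off the corner of size `min(η/2, R + 1)`. [folklore] -/
theorem exists_dyadicUnion_corner_nhds (K : BubbleConfig) {z : ℂ} (hzH : z ∈ upperHalfPlaneSet)
    (hzK : z ∉ (K : Set ℂ)) :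
    ∃ (n : ℕ) (F : Finset (ℤ × ℤ)) (δ : ℝ), dyadicUnion n F ∈ 𝓝 z ∧
      IsConnected (dyadicUnion n F ∪ {w : ℂ | w.im ≤ 0}) ∧ 0 < δ ∧
        (∀ w ∈ dyadicUnion n F, δ ≤ w.im ∨ δ ≤ w.re) ∧ Disjoint (K : Set ℂ) (dyadicUnion n F) := by
  -- the open connected set `U = ℍ ∖ K` contains `z`, a closed disc about `z`, and the far point `w₀`
  set U : Set ℂ := upperHalfPlaneSet \ (K : Set ℂ) with hU
  have hUo : IsOpen U := K.isOpen_diff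
  have hUc : IsConnected U := K.isConnected_diff
  have hzU : z ∈ U := ⟨hzH, hzK⟩
  obtain ⟨ε₀, hε₀, hε₀U⟩ : ∃ ε₀ > 0, closedBall z ε₀ ⊆ U := by
    obtain ⟨ε, hε, hεU⟩ := Metric.isOpen_iff.1 hUo z hzU
    exact ⟨ε / 2, half_pos hε, (closedBall_subset_ball (half_lt_self hε)).trans hεU⟩
  obtain ⟨R, hRpos, hR⟩ := K.isBounded.subset_closedBall_lt 0 0
  set w₀ : ℂ := ((R + 2 : ℝ) : ℂ) + Complex.I with hw₀
  have hw₀re : w₀.re = R + 2 := by simp [hw₀]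
  have hw₀im : w₀.im = 1 := by simp [hw₀]
  have hfar : ∀ w : ℂ, w.re = R + 2 → w ∉ closure (K : Set ℂ) := fun w hw hcl ↦ by
    rw [K.closure_eq] at hcl
    rcases hcl with h | h
    · have h1 := hR h
      rw [mem_closedBall, dist_zero_right] at h1
      have h2 := (Complex.re_le_norm w).trans h1
      rw [hw] at h2
      linarith
    · rw [mem_singleton_iff] at h
      rw [h, Complex.zero_re] at hw
      linarith
  have hw₀U : w₀ ∈ U := by
    refine ⟨by rw [show w₀ ∈ upperHalfPlaneSet ↔ 0 < w₀.im from Iff.rfl, hw₀im]; exact one_pos,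
      fun h ↦ hfar w₀ hw₀re (subset_closure h)⟩
  -- a path from `z` to `w₀` inside `U`, the disc, and the stick from `w₀` down to `R + 2`
  have hJ : JoinedIn U z w₀ := (hUo.isConnected_iff_isPathConnected.1 hUc).joinedIn z hzU _ hw₀U
  set π : Path z w₀ := hJ.somePath with hπ
  have hπU : ∀ t, π t ∈ U := hJ.somePath_mem
  set T : Set ℂ := (fun t : ℝ ↦ ((R + 2 : ℝ) : ℂ) + t * Complex.I) '' Icc 0 1 with hT
  have hTre : ∀ w ∈ T, w.re = R + 2 := by
    rintro _ ⟨t, -, rfl⟩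
    simp
  have hw₀T : w₀ ∈ T := ⟨1, ⟨zero_le_one, le_rfl⟩, by simp [hw₀]⟩
  have hfootT : (((R + 2 : ℝ) : ℂ)) ∈ T := ⟨0, ⟨le_rfl, zero_le_one⟩, by simp⟩
  set C₀ : Set ℂ := range π ∪ closedBall z ε₀ with hC₀
  set C : Set ℂ := C₀ ∪ T with hC
  have hC₀c : IsCompact C₀ := (isCompact_range π.continuous).union (isCompact_closedBall z ε₀)
  have hTc : IsCompact T := isCompact_Icc.image (by fun_prop)
  have hCc : IsCompact C := hC₀c.union hTc
  have hzball : z ∈ closedBall z ε₀ := mem_closedBall_self hε₀.le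
  have hzC₀ : z ∈ C₀ := Or.inr hzball
  have hzC : z ∈ C := Or.inl hzC₀
  -- `C` lies in the open set `O = (cl K)ᶜ`
  set O : Set ℂ := (closure (K : Set ℂ))ᶜ with hO
  have hOo : IsOpen O := isClosed_closure.isOpen_compl
  have hC₀U : C₀ ⊆ U := by
    rintro w (⟨t, rfl⟩ | hw)
    · exact hπU t
    · exact hε₀U hw
  have hCO : C ⊆ O := by
    rintro w (hw | hw)
    · exact notMem_closure (hC₀U hw).1 (hC₀U hw).2
    · exact hfar w (hTre w hw)
  -- `C` is connected and attached to the real axis at `R + 2`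
  have hC₀conn : IsConnected C₀ :=
    IsConnected.union ⟨z, ⟨0, π.source⟩, hzball⟩ (isConnected_range π.continuous)
      ((convex_closedBall z ε₀).isConnected ⟨z, hzball⟩)
  have hTconn : IsConnected T := (isConnected_Icc zero_le_one).image _ (by fun_prop)
  have hCconn : IsConnected C := IsConnected.union ⟨w₀, Or.inl ⟨1, π.target⟩, hw₀T⟩ hC₀conn hTconn
  -- `η = min Im` on the path and the disc is positive
  obtain ⟨c₀, hc₀, hc₀min⟩ := hC₀c.exists_isMinOn ⟨z, hzC₀⟩ Complex.continuous_im.continuousOn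
  set η : ℝ := c₀.im with hη
  have hηpos : 0 < η := (hC₀U hc₀).1
  have hηle : ∀ c ∈ C₀, η ≤ c.im := fun c hc ↦ hc₀min hc
  -- a fine generation `n`
  obtain ⟨δ, hδ, hδO⟩ := hCc.exists_cthickening_subset_open hOo hCO
  set ε : ℝ := min δ (min (η / 2) 1) with hε
  have hεpos : 0 < ε := lt_min hδ (lt_min (half_pos hηpos) one_pos)
  have hεδ : ε ≤ δ := min_le_left _ _
  have hεη : ε ≤ η / 2 := (min_le_right _ _).trans (min_le_left _ _)
  have hε1 : ε ≤ 1 := (min_le_right _ _).trans (min_le_right _ _)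
  obtain ⟨n, hn⟩ : ∃ n : ℕ, (2 : ℝ) / 2 ^ n ≤ ε := by
    obtain ⟨n, hn⟩ := exists_nat_gt (2 / ε)
    refine ⟨n, ?_⟩
    have h2n : (n : ℝ) < 2 ^ n := by exact_mod_cast Nat.lt_two_pow_self
    have h2 : (0 : ℝ) < 2 ^ n := by positivity
    rw [div_le_iff₀ h2]
    rw [div_lt_iff₀ hεpos] at hn
    nlinarith
  -- the squares meeting `C`
  set F : Finset (ℤ × ℤ) := (finite_setOf_dyadicSquare_inter_nonempty hCc.isBounded n).toFinset with hF
  have hmemF : ∀ p : ℤ × ℤ, p ∈ F ↔ (dyadicSquare n p.1 p.2 ∩ C).Nonempty := fun p ↦ by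
    rw [hF, Set.Finite.mem_toFinset]
    rfl
  set S : Set ℂ := dyadicUnion n F with hS
  -- `C ⊆ S ⊆ O`, and every point of `S` is within `ε` of `C`
  have hCS : C ⊆ S := fun w hw ↦ by
    rw [hS, mem_dyadicUnion_iff]
    exact ⟨⟨_, _⟩, (hmemF _).2 ⟨w, mem_dyadicSquare_floor w n, hw⟩, mem_dyadicSquare_floor w n⟩
  have hnear : ∀ w ∈ S, ∃ c ∈ C, dist w c ≤ ε := fun w hw ↦ by
    rw [hS, mem_dyadicUnion_iff] at hw
    obtain ⟨p, hp, hwp⟩ := hw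
    obtain ⟨c, hcp, hcC⟩ := (hmemF p).1 hp
    exact ⟨c, hcC, (dist_le_of_mem_dyadicSquare hwp hcp).trans hn⟩
  have hSO : S ⊆ O := fun w hw ↦ by
    obtain ⟨c, hcC, hwc⟩ := hnear w hw
    exact hδO (mem_cthickening_of_dist_le w c δ C hcC (hwc.trans hεδ))
  -- points of `S` are high (near the path or the disc) or far to the right (near the stick)
  have hSloc : ∀ w ∈ S, η / 2 ≤ w.im ∨ R + 1 ≤ w.re := fun w hw ↦ by
    obtain ⟨c, hcC, hwc⟩ := hnear w hw
    rw [dist_eq_norm] at hwc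
    rcases hcC with hc | hc
    · left
      have h1 := (Complex.abs_im_le_norm (w - c)).trans hwc
      rw [Complex.sub_im, abs_le] at h1
      linarith [hηle c hc, h1.1]
    · right
      have h1 := (Complex.abs_re_le_norm (w - c)).trans hwc
      rw [Complex.sub_re, abs_le, hTre c hc] at h1
      linarith [h1.1]
  have hKS : Disjoint (K : Set ℂ) S :=
    Set.disjoint_left.2 fun w hwK hwS ↦ hSO hwS (subset_closure hwK)
  -- `S ∪ {Im ≤ 0}` is connected: every square meets the connected set `C ∪ {Im ≤ 0} ∋ R + 2`
  have hconn : IsConnected (S ∪ {w : ℂ | w.im ≤ 0}) := by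
    have hfoot0 : (((R + 2 : ℝ) : ℂ)) ∈ {w : ℂ | w.im ≤ 0} := by simp
    have hD : IsPreconnected (C ∪ {w : ℂ | w.im ≤ 0}) :=
      (hCconn.union ⟨((R + 2 : ℝ) : ℂ), Or.inr hfootT, hfoot0⟩
        ((convex_halfSpace_im_le 0).isConnected ⟨0, by simp⟩)).isPreconnected
    have hDsub : C ∪ {w : ℂ | w.im ≤ 0} ⊆ S ∪ {w : ℂ | w.im ≤ 0} := union_subset_union_left _ hCS
    refine ⟨⟨_, Or.inl (hCS (Or.inr hfootT))⟩, isPreconnected_of_forall (((R + 2 : ℝ) : ℂ)) ?_⟩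
    rintro y (hy | hy)
    · rw [hS, mem_dyadicUnion_iff] at hy
      obtain ⟨p, hp, hyp⟩ := hy
      obtain ⟨c, hcp, hcC⟩ := (hmemF p).1 hp
      refine ⟨dyadicSquare n p.1 p.2 ∪ (C ∪ {w : ℂ | w.im ≤ 0}), ?_, Or.inr (Or.inl (Or.inr hfootT)),
        Or.inl hyp, ?_⟩
      · refine union_subset (fun w hw ↦ Or.inl ?_) hDsub
        rw [hS, mem_dyadicUnion_iff]
        exact ⟨p, hp, hw⟩
      · exact IsPreconnected.union c hcp (Or.inl hcC) convex_dyadicSquare.isPreconnected hD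
    · exact ⟨C ∪ {w : ℂ | w.im ≤ 0}, hDsub, Or.inl (Or.inr hfootT), Or.inr hy, hD⟩
  refine ⟨n, F, min (η / 2) (R + 1), ?_, hconn, lt_min (half_pos hηpos) (by linarith),
    fun w hw ↦ ?_, hKS⟩
  · exact mem_of_superset (closedBall_mem_nhds z hε₀) fun w hw ↦ hCS (Or.inl (Or.inr hw))
  · rcases hSloc w hw with h | h
    · exact Or.inl ((min_le_left _ _).trans h)
    · exact Or.inr ((min_le_right _ _).trans h)

/-- **A point of `ℍ` off a bubble lies in a finite union of dyadic squares which is attached to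
the real axis, off a corner at `0`, and avoided by the bubble** (`exists_dyadicUnion_corner_nhds`).
[folklore] -/
theorem exists_dyadicUnion_corner (K : BubbleConfig) {z : ℂ} (hzH : z ∈ upperHalfPlaneSet)
    (hzK : z ∉ (K : Set ℂ)) :
    ∃ (n : ℕ) (F : Finset (ℤ × ℤ)) (δ : ℝ), z ∈ dyadicUnion n F ∧
      IsConnected (dyadicUnion n F ∪ {w : ℂ | w.im ≤ 0}) ∧ 0 < δ ∧
        (∀ w ∈ dyadicUnion n F, δ ≤ w.im ∨ δ ≤ w.re) ∧ Disjoint (K : Set ℂ) (dyadicUnion n F) := by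
  obtain ⟨n, F, δ, hnhds, hconn, hδ, hSδ, hKS⟩ := K.exists_dyadicUnion_corner_nhds hzH hzK
  exact ⟨n, F, δ, mem_of_mem_nhds hnhds, hconn, hδ, hSδ, hKS⟩

/-! ### The σ-field of the attached hitting events sees interior points -/

/-- **`{int K ≠ ∅}` is measurable for the σ-field generated by the attached hitting events**:
`{int K ≠ ∅} = ⋃_B ⋂_S {K ∩ S ≠ ∅}`, the union over the rational discs `B ⊆ ℍ` and the
intersection over the finite unions `S` of dyadic squares, attached to the real axis and off a
corner at `0`, which meet `B` — a bubble containing `B` hits every such `S`, and a bubble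
missing a point `z ∈ B` misses some such `S ∋ z` (`exists_dyadicUnion_corner`). [folklore] -/
theorem measurableSet_generateFrom_interior_nonempty :
    MeasurableSet[MeasurableSpace.generateFrom
      {E : Set BubbleConfig | ∃ (S : Set ℂ) (δ : ℝ), IsClosed S ∧ IsBounded S ∧
        IsConnected (S ∪ {z : ℂ | z.im ≤ 0}) ∧ 0 < δ ∧ (∀ z ∈ S, δ ≤ z.im ∨ δ ≤ z.re) ∧
          E = BubbleConfig.hit S}]
      {K : BubbleConfig | (interior (K : Set ℂ)).Nonempty} := by
  -- the attached dyadic test sets off a corner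
  set ι := {i : ℕ × Finset (ℤ × ℤ) // IsConnected (dyadicUnion i.1 i.2 ∪ {w : ℂ | w.im ≤ 0}) ∧
    ∃ δ : ℝ, 0 < δ ∧ ∀ w ∈ dyadicUnion i.1 i.2, δ ≤ w.im ∨ δ ≤ w.re} with hι
  -- the rational discs inside `ℍ`: centre `a + ib`, radius `r`, `0 < r < b`
  set Q := {q : ℚ × ℚ × ℚ // (0 : ℝ) < q.2.2 ∧ ((q.2.2 : ℚ) : ℝ) < q.2.1} with hQ
  set ctr : Q → ℂ := fun q ↦ (((q.1.1 : ℚ) : ℝ) : ℂ) + (((q.1.2.1 : ℚ) : ℝ) : ℂ) * Complex.I with hctr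
  set rad : Q → ℝ := fun q ↦ ((q.1.2.2 : ℚ) : ℝ) with hrad
  have hctr_im : ∀ q : Q, (ctr q).im = ((q.1.2.1 : ℚ) : ℝ) := fun q ↦ by simp [hctr]
  have hctr_re : ∀ q : Q, (ctr q).re = ((q.1.1 : ℚ) : ℝ) := fun q ↦ by simp [hctr]
  have hballH : ∀ q : Q, ball (ctr q) (rad q) ⊆ upperHalfPlaneSet := fun q w hw ↦ by
    rw [mem_ball, dist_eq_norm] at hw
    have h1 := (Complex.abs_im_le_norm (w - ctr q)).trans_lt hw
    rw [Complex.sub_im, abs_lt, hctr_im] at h1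
    show 0 < w.im
    have := q.2.2
    simp only [hrad] at h1
    linarith [h1.1]
  -- the decomposition
  have key : {K : BubbleConfig | (interior (K : Set ℂ)).Nonempty} =
      ⋃ q : Q, ⋂ i : {i : ι // (dyadicUnion i.1.1 i.1.2 ∩ ball (ctr q) (rad q)).Nonempty},
        hit (dyadicUnion i.1.1.1 i.1.1.2) := by
    ext K
    simp only [mem_setOf_eq, mem_iUnion, mem_iInter]
    constructor
    · rintro ⟨w, hw⟩
      -- a rational disc around `w` inside `int K`
      obtain ⟨ε, hε, hεK⟩ := Metric.isOpen_iff.1 isOpen_interior w hw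
      have hwim : 0 < w.im := K.subset_upperHalfPlaneSet (interior_subset hw)
      obtain ⟨r, hr0, hr⟩ := exists_rat_btwn (lt_min (div_pos hε three_pos) (div_pos hwim three_pos))
      have hrε : (r : ℝ) < ε / 3 := hr.trans_le (min_le_left _ _)
      have hrw : (r : ℝ) < w.im / 3 := hr.trans_le (min_le_right _ _)
      obtain ⟨a, ha1, ha2⟩ := exists_rat_btwn (show w.re - r / 2 < w.re + r / 2 by linarith)
      obtain ⟨b, hb1, hb2⟩ := exists_rat_btwn (show w.im - r / 2 < w.im + r / 2 by linarith)
      have hq : (0 : ℝ) < ((a, b, r) : ℚ × ℚ × ℚ).2.2 ∧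
          ((((a, b, r) : ℚ × ℚ × ℚ).2.2 : ℚ) : ℝ) < ((a, b, r) : ℚ × ℚ × ℚ).2.1 := by
        refine ⟨hr0, ?_⟩
        show (r : ℝ) < b
        linarith
      refine ⟨⟨(a, b, r), hq⟩, ?_⟩
      rintro ⟨⟨⟨n, F⟩, -⟩, ⟨u, huS, hu⟩⟩
      -- `u ∈ B(ctr, r) ⊆ B(w, ε) ⊆ int K ⊆ K`
      have huw : dist u w < ε := by
        have h1 : dist u (ctr ⟨(a, b, r), hq⟩) < r := hu
        have h2 : dist (ctr ⟨(a, b, r), hq⟩) w < r := by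
          rw [dist_eq_norm]
          refine (Complex.norm_le_abs_re_add_abs_im _).trans_lt ?_
          rw [Complex.sub_re, Complex.sub_im, hctr_re, hctr_im]
          have h3 : |(a : ℝ) - w.re| < r / 2 := abs_lt.2 ⟨by linarith, by linarith⟩
          have h4 : |(b : ℝ) - w.im| < r / 2 := abs_lt.2 ⟨by linarith, by linarith⟩
          show |((((a, b, r) : ℚ × ℚ × ℚ).1 : ℚ) : ℝ) - w.re| +
            |((((a, b, r) : ℚ × ℚ × ℚ).2.1 : ℚ) : ℝ) - w.im| < r
          linarith
        linarith [dist_triangle u (ctr ⟨(a, b, r), hq⟩) w]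
      have huK : u ∈ (K : Set ℂ) := interior_subset (hεK huw)
      rw [mem_hit]
      exact fun hd ↦ Set.disjoint_left.1 hd huK huS
    · rintro ⟨q, hq⟩
      -- the disc `B(ctr q, rad q)` lies in `K`
      have hsub : ball (ctr q) (rad q) ⊆ (K : Set ℂ) := fun u hu ↦ by
        by_contra huK
        obtain ⟨n, F, δ, huS, hconn, hδ, hSδ, hKS⟩ := K.exists_dyadicUnion_corner (hballH q hu) huK
        have h := hq ⟨⟨(n, F), hconn, δ, hδ, hSδ⟩, u, huS, hu⟩
        rw [mem_hit] at h
        exact h hKS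
      refine ⟨ctr q, interior_mono hsub ?_⟩
      rw [interior_eq_iff_isOpen.2 isOpen_ball]
      exact mem_ball_self q.2.1
  rw [key]
  refine MeasurableSet.iUnion fun q ↦ MeasurableSet.iInter fun i ↦
    MeasurableSpace.measurableSet_generateFrom ?_
  obtain ⟨hconn, δ, hδ, hSδ⟩ := i.1.2
  exact ⟨_, δ, isClosed_dyadicUnion, isBounded_dyadicUnion, hconn, hδ, hSδ, rfl⟩

end BubbleConfig

/-! ### The attached hitting events generate the avoidance σ-field: (7.2) determines `μ` -/

/-- A finite union of sets attached to the real axis is attached to the real axis. [folklore] -/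
theorem isConnected_biUnion_union_im_le {α : Type*} (t : Finset α) (g : α → Set ℂ)
    (hg : ∀ u ∈ t, IsConnected (g u ∪ {w : ℂ | w.im ≤ 0})) :
    IsConnected ((⋃ u ∈ t, g u) ∪ {w : ℂ | w.im ≤ 0}) := by
  refine ⟨⟨0, Or.inr (by simp)⟩, isPreconnected_of_forall 0 ?_⟩
  rintro y (hy | hy)
  · obtain ⟨u, hu, hyu⟩ := mem_iUnion₂.1 hy
    exact ⟨g u ∪ {w : ℂ | w.im ≤ 0}, union_subset_union_left _ (subset_biUnion_of_mem hu),
      Or.inr (by simp), Or.inl hyu, (hg u hu).isPreconnected⟩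
  · exact ⟨{w : ℂ | w.im ≤ 0}, subset_union_right, by simp, hy,
      (convex_halfSpace_im_le 0).isPreconnected⟩

namespace BubbleConfig

/-- **The hitting event of a `*`-hull is measurable for the σ-field generated by the attached
hitting events**: `{K ∩ A ≠ ∅} = ⋃ₘ {K ∩ A_m ≠ ∅}` with the compact slabs
`A_m = A ∩ {Im ≥ 1/(m+1)} ⊆ ℍ` (bubbles lie in `ℍ`), and `{K ∩ A_m ≠ ∅} = ⋂_S {K ∩ S ≠ ∅}`
over the finite unions `S ⊇ A_m` of dyadic test sets attached to the real axis and off a corner: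
a bubble `K` avoiding `A_m` avoids such an `S`, obtained from a finite subcover of the
neighbourhoods `exists_dyadicUnion_corner_nhds` of the points of `A_m`, all avoided by `K`.
[folklore] -/
theorem measurableSet_generateFrom_hit {A : Set ℂ} (hA : IsStarHull A) :
    MeasurableSet[MeasurableSpace.generateFrom
      {E : Set BubbleConfig | ∃ (S : Set ℂ) (δ : ℝ), IsClosed S ∧ IsBounded S ∧
        IsConnected (S ∪ {z : ℂ | z.im ≤ 0}) ∧ 0 < δ ∧ (∀ z ∈ S, δ ≤ z.im ∨ δ ≤ z.re) ∧
          E = BubbleConfig.hit S}] (hit A) := by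
  classical
  -- finite unions of dyadic unions
  set SJ : Finset (ℕ × Finset (ℤ × ℤ)) → Set ℂ := fun J ↦ ⋃ i ∈ J, dyadicUnion i.1 i.2 with hSJ
  have hSJclosed : ∀ J, IsClosed (SJ J) := fun J ↦
    J.finite_toSet.isClosed_biUnion fun i _ ↦ isClosed_dyadicUnion
  have hSJbdd : ∀ J, IsBounded (SJ J) := fun J ↦
    (isBounded_biUnion J.finite_toSet).2 fun i _ ↦ isBounded_dyadicUnion
  -- the compact slabs `A_m = A ∩ {Im ≥ 1/(m+1)} ⊆ ℍ`
  set Am : ℕ → Set ℂ := fun m ↦ A ∩ {z : ℂ | (1 : ℝ) / (m + 1) ≤ z.im} with hAm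
  have hAmc : ∀ m, IsCompact (Am m) := fun m ↦
    Metric.isCompact_of_isClosed_isBounded
      (hA.1.isClosed.inter (isClosed_le continuous_const Complex.continuous_im))
      (hA.1.1.subset inter_subset_left)
  have hAmH : ∀ m, Am m ⊆ upperHalfPlaneSet := fun m z hz ↦
    show 0 < z.im from lt_of_lt_of_le (by positivity) hz.2
  -- the index types of the intersections
  set ι : ℕ → Type := fun m ↦ {J : Finset (ℕ × Finset (ℤ × ℤ)) //
    IsConnected (SJ J ∪ {w : ℂ | w.im ≤ 0}) ∧
      (∃ δ : ℝ, 0 < δ ∧ ∀ w ∈ SJ J, δ ≤ w.im ∨ δ ≤ w.re) ∧ Am m ⊆ SJ J} with hι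
  have key : hit A = ⋃ m : ℕ, ⋂ J : ι m, hit (SJ J.1) := by
    ext K
    simp only [mem_iUnion, mem_iInter, mem_hit]
    constructor
    · intro hK
      obtain ⟨w, hwK, hwA⟩ := Set.not_disjoint_iff.1 hK
      have hwim : 0 < w.im := K.subset_upperHalfPlaneSet hwK
      obtain ⟨m, hm⟩ := exists_nat_ge (1 / w.im)
      have hwAm : w ∈ Am m := by
        refine ⟨hwA, ?_⟩
        show (1 : ℝ) / (m + 1) ≤ w.im
        rw [div_le_iff₀ (by positivity)]
        rw [div_le_iff₀ hwim] at hm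
        nlinarith
      exact ⟨m, fun J ↦ Set.not_disjoint_iff.2 ⟨w, hwK, J.2.2.2 hwAm⟩⟩
    · rintro ⟨m, hm⟩
      by_contra hKA
      have hd : Disjoint (K : Set ℂ) A := by simpa using hKA
      have hdm : Disjoint (K : Set ℂ) (Am m) := hd.mono_right inter_subset_left
      -- attached dyadic neighbourhoods of the points of `A_m`, avoided by `K`
      have hex : ∀ u ∈ Am m, ∃ q : (ℕ × Finset (ℤ × ℤ)) × ℝ, dyadicUnion q.1.1 q.1.2 ∈ 𝓝 u ∧
          IsConnected (dyadicUnion q.1.1 q.1.2 ∪ {w : ℂ | w.im ≤ 0}) ∧ 0 < q.2 ∧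
            (∀ w ∈ dyadicUnion q.1.1 q.1.2, q.2 ≤ w.im ∨ q.2 ≤ w.re) ∧
              Disjoint (K : Set ℂ) (dyadicUnion q.1.1 q.1.2) := by
        intro u hu
        obtain ⟨n, F, δ, h1, h2, h3, h4, h5⟩ := K.exists_dyadicUnion_corner_nhds (hAmH m hu)
          (fun huK ↦ Set.disjoint_left.1 hdm huK hu)
        exact ⟨((n, F), δ), h1, h2, h3, h4, h5⟩
      choose! f hf using hex
      obtain ⟨t, htA, hcov⟩ := (hAmc m).elim_nhds_subcover (fun u ↦ dyadicUnion (f u).1.1 (f u).1.2)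
        (fun u hu ↦ (hf u hu).1)
      set J : Finset (ℕ × Finset (ℤ × ℤ)) := t.image fun u ↦ (f u).1 with hJ
      have hSJ_eq : SJ J = ⋃ u ∈ t, dyadicUnion (f u).1.1 (f u).1.2 := by
        simp only [hSJ, hJ]
        exact Finset.set_biUnion_finset_image
      have hconnJ : IsConnected (SJ J ∪ {w : ℂ | w.im ≤ 0}) := by
        rw [hSJ_eq]
        exact isConnected_biUnion_union_im_le t _ fun u hu ↦ (hf u (htA u hu)).2.1
      have hcorner : ∃ δ : ℝ, 0 < δ ∧ ∀ w ∈ SJ J, δ ≤ w.im ∨ δ ≤ w.re := by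
        rcases t.eq_empty_or_nonempty with ht | ht
        · refine ⟨1, one_pos, fun w hw ↦ ?_⟩
          rw [hSJ_eq, ht] at hw
          simp at hw
        · obtain ⟨u₀, hu₀, hmin⟩ := t.exists_min_image (fun u ↦ (f u).2) ht
          refine ⟨(f u₀).2, (hf u₀ (htA u₀ hu₀)).2.2.1, fun w hw ↦ ?_⟩
          rw [hSJ_eq] at hw
          obtain ⟨u, hu, hwu⟩ := mem_iUnion₂.1 hw
          rcases (hf u (htA u hu)).2.2.2.1 w hwu with h | h
          · exact Or.inl ((hmin u hu).trans h)
          · exact Or.inr ((hmin u hu).trans h)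
      have hcovJ : Am m ⊆ SJ J := by
        rw [hSJ_eq]
        exact hcov
      have hdisjJ : Disjoint (K : Set ℂ) (SJ J) := by
        rw [hSJ_eq]
        exact Set.disjoint_iUnion₂_right.2 fun u hu ↦ (hf u (htA u hu)).2.2.2.2
      exact hm ⟨J, hconnJ, hcorner, hcovJ⟩ hdisjJ
  rw [key]
  refine MeasurableSet.iUnion fun m ↦ MeasurableSet.iInter fun J ↦
    MeasurableSpace.measurableSet_generateFrom ?_
  obtain ⟨hconn, ⟨δ, hδ, hSδ⟩, -⟩ := J.2
  exact ⟨SJ J.1, δ, hSJclosed _, hSJbdd _, hconn, hδ, hSδ, rfl⟩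

/-- **The attached hitting events generate the avoidance σ-field of `Ω_b`** (they are
measurable, and the hitting event of every `*`-hull is in the σ-field they generate,
`measurableSet_generateFrom_hit`). [folklore] -/
theorem generateFrom_cornerHits_eq :
    MeasurableSpace.generateFrom
      {E : Set BubbleConfig | ∃ (S : Set ℂ) (δ : ℝ), IsClosed S ∧ IsBounded S ∧
        IsConnected (S ∪ {z : ℂ | z.im ≤ 0}) ∧ 0 < δ ∧ (∀ z ∈ S, δ ≤ z.im ∨ δ ≤ z.re) ∧
          E = BubbleConfig.hit S} = (instMeasurableSpace : MeasurableSpace BubbleConfig) := by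
  refine le_antisymm (MeasurableSpace.generateFrom_le ?_) ?_
  · rintro _ ⟨S, δ, hS, hSb, hSc, hδ, hSδ, rfl⟩
    exact measurableSet_hit_of_corner hS hSb hSc hδ hSδ
  · change MeasurableSpace.generateFrom {S | ∃ A, IsStarHull A ∧ S = avoid A} ≤ _
    refine MeasurableSpace.generateFrom_le ?_
    rintro _ ⟨A, hA, rfl⟩
    rw [show avoid A = (hit A)ᶜ by rw [hit_eq_compl, compl_compl]]
    exact (measurableSet_generateFrom_hit hA).compl

/-- **`{int K ≠ ∅}` is a measurable event of `Ω_b`.** [folklore] -/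
theorem measurableSet_interior_nonempty :
    MeasurableSet {K : BubbleConfig | (interior (K : Set ℂ)).Nonempty} := by
  rw [← generateFrom_cornerHits_eq]
  exact measurableSet_generateFrom_interior_nonempty

end BubbleConfig

/-- **The hitting masses (7.2) determine the Brownian bubble measure**: two measures on `Ω_b`
with `μ[K ∩ A ≠ ∅] = −SΦ_A(0)/6` for all `A ∈ 𝒬*` (`IsBrownianBubbleMeasure`) are equal —
the design note of `BrownianBubbles` ("(7.2) determines `μ` on the σ-field generated by the
hitting events … which is not proved here") PROVED, and the bubble analogue of [LSW] Lemma 3.2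
/ §3 p. 10 ("a probability measure on `Ω` is characterized by the values of `P[K ∩ A = ∅]`"):
all such measures agree on the σ-field of the attached hitting events
(`measure_eq_of_measurableSet_generateFrom`), which is the whole avoidance σ-field
(`BubbleConfig.generateFrom_cornerHits_eq`). Hence the tree's `IsBrownianBubbleMeasure μ` singles
out [LSW]'s measure `μ` of §7.1 as soon as it exists (`exists_isBrownianBubbleMeasure`).
[cite: LawlerSchrammWerner2003Restriction, §7.1 eq. (7.2) (p. 28) with Lemma 3.2 (p. 10)] -/
theorem IsBrownianBubbleMeasure.unique {μ ν : Measure BubbleConfig} (hμ : IsBrownianBubbleMeasure μ)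
    (hν : IsBrownianBubbleMeasure ν) : μ = ν := by
  ext E hE
  refine hμ.measure_eq_of_measurableSet_generateFrom hν ?_
  rw [BubbleConfig.generateFrom_cornerHits_eq]
  exact hE

/-- **Transfer by uniqueness**: an almost-sure property of bubbles established for ONE Brownian
bubble measure holds for every Brownian bubble measure. [folklore] -/
theorem IsBrownianBubbleMeasure.ae_of_exists {p : BubbleConfig → Prop}
    (h : ∃ μ₀ : Measure BubbleConfig, IsBrownianBubbleMeasure μ₀ ∧ ∀ᵐ K ∂μ₀, p K)
    {μ : Measure BubbleConfig} (hμ : IsBrownianBubbleMeasure μ) : ∀ᵐ K ∂μ, p K := by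
  obtain ⟨μ₀, hμ₀, h₀⟩ := h
  rwa [hμ.unique hμ₀]

/-! ### The interior property for every Brownian bubble measure, from the existential fact -/

/-- **`IsBrownianBubbleMeasure.ae_interior_nonempty` from the existential fact**: if SOME
measure with the hitting masses (7.2) gives full measure to the bubbles with an interior point
(`exists_isBrownianBubbleMeasure_ae_interior_nonempty`, [LSW]'s `μ` of §7.1), then EVERY
measure with the hitting masses (7.2) does — all of them agree on the σ-field of the attached
hitting events, which contains the event `{int K = ∅}`.
[cite: LawlerSchrammWerner2003Restriction, §7.1 eq. (7.2) (pp. 27–28) with §3 p. 10] -/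
theorem IsBrownianBubbleMeasure.ae_interior_nonempty_of_exists
    (hex : exists_isBrownianBubbleMeasure_ae_interior_nonempty) :
    IsBrownianBubbleMeasure.ae_interior_nonempty := by
  intro μ hμ
  obtain ⟨μ₀, hμ₀, hfat⟩ := hex
  rw [ae_iff] at hfat ⊢
  have hmeas := (BubbleConfig.measurableSet_generateFrom_interior_nonempty).compl
  rw [show {K : BubbleConfig | ¬ (interior (K : Set ℂ)).Nonempty} =
      {K : BubbleConfig | (interior (K : Set ℂ)).Nonempty}ᶜ from rfl,
    hμ.measure_eq_of_measurableSet_generateFrom hμ₀ hmeas]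
  exact hfat

/-- **`SLEBubbles.ae_interior_nonempty` from the existential fact**: for `0 < κ < 8/3`, EVERY
Brownian bubble measure `μ` (in the sense of (7.2)) and every independent Poisson cloud of
bubbles with mean `λ_κ μ ⊗ dt`, almost surely `Ξ(κ)` has an interior point — from [LSW]'s one
measure of filled Brownian loops (`exists_isBrownianBubbleMeasure_ae_interior_nonempty`) through
`IsBrownianBubbleMeasure.ae_interior_nonempty_of_exists` and the tree's
`SLEBubbles.ae_interior_nonempty_of_ae_interior_nonempty`.
[cite: LawlerSchrammWerner2003Restriction, Thm. 7.3 and p. 29 with §7.1 (pp. 27–28)] -/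
theorem SLEBubbles.ae_interior_nonempty_of_exists
    (hex : exists_isBrownianBubbleMeasure_ae_interior_nonempty) : SLEBubbles.ae_interior_nonempty :=
  SLEBubbles.ae_interior_nonempty_of_ae_interior_nonempty
    (IsBrownianBubbleMeasure.ae_interior_nonempty_of_exists hex)

/-! ### Bookkeeping: the three named facts about `μ` are two

With uniqueness proved, the existential fact of `SLEBubblesAssembly` is EXACTLY the conjunction
of the two facts of `BrownianBubbles`:
`exists_isBrownianBubbleMeasure_ae_interior_nonempty ↔
  exists_isBrownianBubbleMeasure ∧ IsBrownianBubbleMeasure.ae_interior_nonempty`.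
In particular `IsBrownianBubbleMeasure.ae_interior_nonempty` carries no content beyond the
existential fact (review of the D-0026 decomposition, 2026-08-15): its discharge is the one-liner
`IsBrownianBubbleMeasure.ae_interior_nonempty_of_exists h` once
`h : exists_isBrownianBubbleMeasure_ae_interior_nonempty` is proved ([LSW] §7.1: the measure of
filled Brownian loops, (7.2) by [Lawler] Prop. 5.22), and no proof of it avoiding that
construction is known (any measure with the hitting masses (7.2) IS that measure, `unique`). -/

/-- The existential fact gives back the existence fact `exists_isBrownianBubbleMeasure` of
`BrownianBubbles` (forget the interior clause). [folklore] -/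
theorem exists_isBrownianBubbleMeasure_of_exists_ae_interior_nonempty
    (hex : exists_isBrownianBubbleMeasure_ae_interior_nonempty) : exists_isBrownianBubbleMeasure := by
  obtain ⟨μ, hμ, -⟩ := hex
  exact ⟨μ, hμ⟩

/-- **`∃ μ with (7.2) and interior points` ↔ `(∃ μ with (7.2)) ∧ (every μ with (7.2) has interior
points a.e.)`**: the forward direction is uniqueness of the measure with the hitting masses (7.2)
(`IsBrownianBubbleMeasure.ae_interior_nonempty_of_exists`), the backward one is
`exists_isBrownianBubbleMeasure_ae_interior_nonempty_of_facts`.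
[cite: LawlerSchrammWerner2003Restriction, §7.1 eq. (7.2) (pp. 27–28) with §3 p. 10] -/
theorem exists_isBrownianBubbleMeasure_ae_interior_nonempty_iff :
    exists_isBrownianBubbleMeasure_ae_interior_nonempty ↔
      exists_isBrownianBubbleMeasure ∧ IsBrownianBubbleMeasure.ae_interior_nonempty :=
  ⟨fun h ↦ ⟨exists_isBrownianBubbleMeasure_of_exists_ae_interior_nonempty h,
      IsBrownianBubbleMeasure.ae_interior_nonempty_of_exists h⟩,
    fun h ↦ exists_isBrownianBubbleMeasure_ae_interior_nonempty_of_facts h.1 h.2⟩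

end Literature.Probability.RandomPlanarGeometry

end
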